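import Literature.MathematicalPhysics.QuantumFieldTheory.Balaban1983to89.B8Thm4Concrete
import Literature.MathematicalPhysics.QuantumFieldTheory.Balaban1983to89.B8Thm4KLevelBdryBeta
import Literature.MathematicalPhysics.QuantumFieldTheory.Balaban1983to89.B8LeafModelZd3

/-!
# `Balaban1983to89.B8Thm4ConcreteBdryBeta` — [Balaban1985RegularSpaces] THEOREM 4 (p. 88) ON THE `ℤᵈ` CARRIERS: EXISTENCE ∕ UNIQUENESS WITH ONE
# THRESHOLD, THE MEMBER SENTENCE `B8.Thm4Body` AND `B8.Thm4Printed` ON INDEX-MAPPED SUB-FAMILIES — the (1.59) socket in EDITION β (`SH59Dβ`)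

statement-level skeleton of published theorems with citation tags; proofs where landed; nothing here is a claim about the
Yang–Mills mass gap

PDF held: `paper:balaban1985-cmp99-regular-spaces-gauge-fixing` (journal page = PDF page + 74); pp. 77, 81–83, 86–89, 94–95, 98–99.

CITATION HEADER (lean-in-tree rule).  Cell `pub-ymgap` (HUMAN RULING D-0062, Track A), DAG node N05 = [B8], seat `pub-ymgap-dag-n05-e` g8 (R141 (C)
row s3b), 2026-08-27.  WHY: g6's repaired Theorem-4 driver `B8Thm4ConcreteBdry` (F6) and member assembly `B8LeafModelZd3Bdry` (F7) read the (1.59) socket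
`SH59D` whose averaging datum misses the level-0 CROSSING bonds of a finite `Ω₀` — unsatisfiable there (dag-n06-b CANDIDATE-3, p539131).  The socket of
record is dag-n06-b's EDITION β `B9SupplySockB9P3ZdBeta.SockB9P3D4β` (dag-lead RULING №189 (2), bus l.20717; p541339).  THIS FILE re-runs F6∕F7 on this
seat's β engine `B8Thm4KLevelBdryBeta`: ★ `thm4Body_concrete_uniform_bdryβ`, ★ `thm4Body_member_zd3_bdryβ`, ★ `thm4Printed_zd3_map_bdryβ` — token swap
`SH59D ↦ SH59Dβ` plus ONE displayed member law, the boundary-layer law («boundary-layer sites of `Ω₀` lie in `Λs m 0` for `1 ≤ m ≤ k`» — (1.29)'s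
level-0 territory contains `∂Ω₀`; true at the cube members of (1.131), NOT a law of the generic `ZdIdx` carrier, so displayed), and the (1.66)₀ level
`a = α₁ ≤ dLα₁`.  Proofs verbatim otherwise.  Kind «kernel-checked proof», theorems only, no `def`.

HONEST SCOPE.  (i) By-name re-threading; the four sockets `SP5base` ∕ `SP5` ∕ `SH59Dβ` ∕ `SP5u` remain HYPOTHESES per member (Prop. 5 ∃ base∕step,
[4] Thm 3.3 WITH exterior data in the β reading — dag-n06-b's member supplier, A6-witnessed at truncation 0 only —, Prop. 5 uniqueness); `B_∂ ≥ 0`,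
`4B_∂ ≤ (dL − 1)B₀` are the tree's.  A6-PARTIAL (ref-E g10 READ-2∕3 on the R-d′ pair, bus l.21032∕l.21074, carried to β): at a
cube member the boundary pure-gauge mode `A′ = t·d𝟙_{□₀}` of p539131 is a datum of the socket with `J = 0`, `Φ₀ = 0` and `|B₁|β = ηt` (its crossing terms), so
the β socket text is FALSE below an absolute threshold in `B₀` (line 1 needs `B₀ ≥ 1`; the gradient ∕ `∂*∂` ∕ `Δ` lines a larger absolute constant) — as in
print, where `B₀` is [4] Thm 3.3's constant; dag-n06-b's supplier delivers `B₀′ = max{1, 2B₀max{1,q}}`.  The theorems here hold for every `B₀ > 0`; below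
that threshold their socket hypothesis is vacuous (partial vacuity, declared; no satisfiability claim of mine).  (ii) Located readings of `B8Thm4Concrete` ∕ `B8LeafModelZd3` apply verbatim.  Count-neutral; N05 NOT discharged;
one finite `𝕋⁴` programme at fixed `ε`, Bałaban as printed; nothing continuum ∕ ℝ⁴ ∕ OS ∕ mass-gap ∕ Clay.  No `sorry`, no `def`, no `instance`,
no `notation`.  Unit `pub-ymgap-dag-n05-e` (g8), 2026-08-27.
-/

noncomputable section

open NormedSpace

namespace Literature.MathematicalPhysics.QuantumFieldTheory.Balaban1983to89.B8Thm4ConcreteBdryBeta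

open Complex (I)
open MatrixLog B7Prop1Explicit B7Prop2Explicit B7Prop1Local B7Eq92Concrete
open B7Prop2Explicit (C0 c2')
open B7Prop3Flat (c3)
open B8Ineq132 (covDerivFwd InAk BondTouches)
open B8Eq119TwistedAxial (Restr129 InAx)
open B8Eq184Proof (gaugeExp cfgExp)
open B8Lemma1NonAbelian (mulCfg)
open B8Eq140Level (SideTouches)
open B8Eq146AExpansion (iEta)
open B7Prop4GeneralLevels (logCovIter linCovIter)
open B8Eq155JBound (Jcur wsup)
open B8ScaledSupNorm (bondNorm msup)
open B8Thm2LogB (blockTop)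
open B8Ineq130 (tlo thi)
open B8Eq138LandauZd (IsLandau138W logCfg)
open B8Prop3GaugeFixedKLevel (eq_mgauge_inv_of_mgauge_eq mem_unitaryUnits_of_mgauge_eq logField_spec)
open B8Thm4SupportLocal (thm4_unique_eq_landau138)
open B8Thm4KLevelBdryBeta (thm4_exists_all_levels_supp_landau138_bdryβ)
open B8Thm4Windows (thm4_windows thm4_windows_extra)
open B8Thm4Concrete (mulCfg_eq_mul)
open B8Thm4AtLandau138 (mgauge_mgauge_inv)
open B8LeafModelZd (SockP5base SockP5 SockP5u ZdIdx)
open B8LeafModelZd3 (mlogCfg mlogCfg_spec zdGF3)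
open B9SupplySockB9P3ZdBeta (CrossB)

-- `Site` alone could resolve to the torus sites of `Setup.lean`; re-export the `ℤ^d` sites of `B7Prop1Explicit`.
export B7Prop1Explicit (Site)

variable {d : ℕ}

/-! ## §1 Theorem 4 on the `ℤᵈ` carriers, one threshold, the (1.59) socket in edition β -/

section Main

variable {𝔸 : Type*} [CStarAlgebra 𝔸] [Nontrivial 𝔸]

/-- ★ **THEOREM 4 (p. 88), EXISTENCE AND UNIQUENESS ON THE `ℤᵈ` CARRIERS, ONE THRESHOLD BEFORE THE DATA, THE (1.59) SOCKET IN EDITION β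
`SH59Dβ`** — g6's `B8Thm4ConcreteBdry.thm4Body_concrete_uniform_bdry` with `SH59D ↦ SH59Dβ` (averaging datum `|B₁|β` over `Λb m j ∪ {level-0 crossing bonds of
Ω₀}` — the body of dag-n06-b's `SockB9P3D4β` at Theorem 4's induction datum, truncation `m`) and ONE more member law, the boundary-layer law `hlay`
(«a site of `Ω₀` with a sup-distance-1 neighbour outside lies in `Λs m 0`», true at the cube members of (1.131)); the (1.66)₀ level `a := α₁ ≤ dLα₁`;
everything else — `SP5base`, `SP5`, `SP5u`, the datum's (1.33)∕(1.34)∕axial∕(1.35)∕(1.66)₀ binders, the threshold `c₁(d, L, B₀, B₀′, cu, cP)`, the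
conclusion ((1.29), (1.38), the (1.62)-shape with `5dLB₀(α₀ + α₁)`, uniqueness) — byte-identical.
[cite: Balaban1985RegularSpaces, Thm 4 p.88, (1.29) p.81, (1.31) p.82, (1.38) p.82, (1.58)–(1.62) pp.86–87, (1.66) p.87, Prop. 5 (1.107)–(1.109) p.94, pp.94–95] -/
theorem thm4Body_concrete_uniform_bdryβ (hd2 : 2 ≤ d) {L : ℕ} (hL : 2 ≤ L)
    {B₀ B₀' cu cP Bbd : ℝ} (hB₀ : 0 < B₀) (hB₀' : 0 < B₀') (hB : 2 ≤ 5 * (d : ℝ) * L * B₀) (hcu : 0 < cu) (hcP : 0 < cP)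
    (hBbd : 0 ≤ Bbd) (hBd : 4 * Bbd ≤ ((d : ℝ) * L - 1) * B₀) :
    ∃ c₁ : ℝ, 0 < c₁ ∧ ∀ (η : ℝ), 0 < η → ∀ (k : ℕ)
    (Ω : ℕ → Set (Site d)) (hΩ : ∀ j, Ω (j + 1) ⊆ Ω j) (Λs : ℕ → ℕ → Set (Site d)) (Λb : ℕ → ℕ → Set (Site d × Fin d))
    (hbox : ∀ m, m ≤ k → ∀ j, j ≤ m → ∀ c ∈ Λb m j, ∀ x, InBox (loK L j c.1) (bondHiK L j c.1 c.2) x → x ∈ Ω j)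
    (hclass : ∀ m, m ≤ k → ∀ j, j ≤ m → ∀ c ∈ Λb m j,
      (c.1 ∈ Λs m j ∧ c.1 + e c.2 ∈ Λs m j) ∨
      (∃ j', j = j' + 1 ∧ (∀ x, (L : ℤ) • c.1 ≤ x → x ≤ (L : ℤ) • c.1 + blockTop L → x ∈ Λs m j') ∧ c.1 + e c.2 ∈ Λs m j) ∨
      (∃ j', j = j' + 1 ∧ c.1 ∈ Λs m j ∧ (∀ x, (L : ℤ) • (c.1 + e c.2) ≤ x → x ≤ (L : ℤ) • (c.1 + e c.2) + blockTop L → x ∈ Λs m j')))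
    (htower : ∀ j, j ≤ k → ∀ y ∈ Λs k j, ∀ x, InBox (tlo L y j) (thi L y j) x → x ∈ Ω j)
    (hpart : ∀ x, x ∈ Ω 0 → ∃ j, j ≤ k ∧ ∃ y ∈ Λs k j, InBox (tlo L y j) (thi L y j) x)
    (hlay : ∀ m, 1 ≤ m → m ≤ k → ∀ y z : Site d, y ∈ Ω 0 → z ∉ Ω 0 → (∀ i, y i - 1 ≤ z i ∧ z i ≤ y i + 1) → y ∈ Λs m 0)
    (SP5base : ∀ α₀ α₁ : ℝ, 0 < α₀ → 0 < α₁ → α₀ + α₁ ≤ cP →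
      ∀ U₀ U' : Site d → Fin d → 𝔸ˣ, (∀ x κ, U₀ x κ ∈ unitaryUnits 𝔸) → (∀ x κ, U' x κ ∈ unitaryUnits 𝔸) →
      InAk L k η α₀ Ω U₀ → InAk L k η α₀ Ω (mulCfg U' U₀) → (∀ m, m ≤ k → InAx L m (Λs m) U₀ (mulCfg U' U₀)) →
      (∀ j, j ≤ k → ∀ (z : Site d) (μ : Fin d), (∀ x, InBox (loK L j z) (bondHiK L j z μ) x → x ∈ Ω j) →
        ‖(avgIter L (mulCfg U' U₀) j z μ : 𝔸) - (avgIter L U₀ j z μ : 𝔸)‖ ≤ α₁) →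
      (∀ b ∈ {b : Site d × Fin d | SideTouches (Ω 0) b.1 b.2}, ‖((U' b.1 b.2 : 𝔸ˣ) : 𝔸) - 1‖ ≤ α₁) →
      (∃ (v : Site d → 𝔸ˣ) (lam : Site d → 𝔸), (∀ x, v x ∈ unitaryUnits 𝔸) ∧ (∀ x, x ∉ Ω 0 → v x = 1) ∧
        (∀ j, j ≤ 1 → ∀ b ∈ {b : Site d × Fin d | SideTouches (Ω j) b.1 b.2}, (v b.1 : 𝔸) = ((gaugeExp lam b.1 : 𝔸ˣ) : 𝔸) ∧
        (v (b.1 + e b.2) : 𝔸) = ((gaugeExp lam (b.1 + e b.2) : 𝔸ˣ) : 𝔸)) ∧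
        (∀ j, j ≤ 1 → ∀ b ∈ {b : Site d × Fin d | SideTouches (Ω j) b.1 b.2},
        ‖lam b.1‖ ≤ (8 * B₀' * (5 * (d : ℝ) * L * B₀) * (α₀ + α₁)) ∧ ((L : ℝ) ^ j * η) * ‖covDerivFwd η U₀ b.2 lam b.1‖ ≤ (8 * B₀' * (5 * (d : ℝ) * L * B₀) * (α₀ + α₁))) ∧
        IsLandau138W L 1 η (Ω 0) (Λs 1) U₀ (mgauge U₀ v⁻¹ U') ∧ Restr129 L 1 (Λs 1) U₀ ((1 : Site d → 𝔸ˣ) * v)))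
    (SP5 : ∀ α₀ α₁ : ℝ, 0 < α₀ → 0 < α₁ → α₀ + α₁ ≤ cP →
      ∀ U₀ U' : Site d → Fin d → 𝔸ˣ, (∀ x κ, U₀ x κ ∈ unitaryUnits 𝔸) → (∀ x κ, U' x κ ∈ unitaryUnits 𝔸) →
      InAk L k η α₀ Ω U₀ → InAk L k η α₀ Ω (mulCfg U' U₀) → (∀ m, m ≤ k → InAx L m (Λs m) U₀ (mulCfg U' U₀)) →
      (∀ j, j ≤ k → ∀ (z : Site d) (μ : Fin d), (∀ x, InBox (loK L j z) (bondHiK L j z μ) x → x ∈ Ω j) →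
        ‖(avgIter L (mulCfg U' U₀) j z μ : 𝔸) - (avgIter L U₀ j z μ : 𝔸)‖ ≤ α₁) →
      (∀ b ∈ {b : Site d × Fin d | SideTouches (Ω 0) b.1 b.2}, ‖((U' b.1 b.2 : 𝔸ˣ) : 𝔸) - 1‖ ≤ α₁) →
      (∀ m, 1 ≤ m → m < k → ∀ (u₁ : Site d → 𝔸ˣ) (U₁ : Site d → Fin d → 𝔸ˣ) (A : Site d → Fin d → 𝔸),
        (∀ x, u₁ x ∈ unitaryUnits 𝔸) → (∀ x, x ∉ Ω 0 → u₁ x = 1) → mgauge U₀ u₁ U₁ = U' → Restr129 L m (Λs m) U₀ u₁ →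
        IsLandau138W L m η (Ω 0) (Λs m) U₀ U₁ →
        (∀ j, j ≤ m → ∀ b ∈ {b : Site d × Fin d | SideTouches (Ω j) b.1 b.2},
        U₁ b.1 b.2 = cfgExp η A b.1 b.2 ∧ IsSelfAdjoint (A b.1 b.2) ∧ ‖A b.1 b.2‖ ≤ (5 * (d : ℝ) * L * B₀ * (α₀ + α₁)) * ((L : ℝ) ^ j * η)⁻¹) →
        ∃ (v : Site d → 𝔸ˣ) (lam : Site d → 𝔸), (∀ x, v x ∈ unitaryUnits 𝔸) ∧ (∀ x, x ∉ Ω 0 → v x = 1) ∧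
        (∀ j, j ≤ m + 1 → ∀ b ∈ {b : Site d × Fin d | SideTouches (Ω j) b.1 b.2}, (v b.1 : 𝔸) = ((gaugeExp lam b.1 : 𝔸ˣ) : 𝔸) ∧
        (v (b.1 + e b.2) : 𝔸) = ((gaugeExp lam (b.1 + e b.2) : 𝔸ˣ) : 𝔸)) ∧
        (∀ j, j ≤ m + 1 → ∀ b ∈ {b : Site d × Fin d | SideTouches (Ω j) b.1 b.2},
        ‖lam b.1‖ ≤ (8 * B₀' * (5 * (d : ℝ) * L * B₀) * (α₀ + α₁)) ∧ ((L : ℝ) ^ j * η) * ‖covDerivFwd η U₀ b.2 lam b.1‖ ≤ (8 * B₀' * (5 * (d : ℝ) * L * B₀) * (α₀ + α₁))) ∧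
        IsLandau138W L (m + 1) η (Ω 0) (Λs (m + 1)) U₀ (mgauge U₀ v⁻¹ U₁) ∧ Restr129 L (m + 1) (Λs (m + 1)) U₀ (u₁ * v)))
    (SH59Dβ : ∀ α₀ α₁ : ℝ, 0 < α₀ → 0 < α₁ → α₀ + α₁ ≤ cP →
      ∀ U₀ U' : Site d → Fin d → 𝔸ˣ, (∀ x κ, U₀ x κ ∈ unitaryUnits 𝔸) → (∀ x κ, U' x κ ∈ unitaryUnits 𝔸) →
      InAk L k η α₀ Ω U₀ → InAk L k η α₀ Ω (mulCfg U' U₀) → (∀ m, m ≤ k → InAx L m (Λs m) U₀ (mulCfg U' U₀)) →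
      (∀ j, j ≤ k → ∀ (z : Site d) (μ : Fin d), (∀ x, InBox (loK L j z) (bondHiK L j z μ) x → x ∈ Ω j) →
        ‖(avgIter L (mulCfg U' U₀) j z μ : 𝔸) - (avgIter L U₀ j z μ : 𝔸)‖ ≤ α₁) →
      (∀ b ∈ {b : Site d × Fin d | SideTouches (Ω 0) b.1 b.2}, ‖((U' b.1 b.2 : 𝔸ˣ) : 𝔸) - 1‖ ≤ α₁) →
      (∀ m, 1 ≤ m → m ≤ k → ∀ (u : Site d → 𝔸ˣ) (W : Site d → Fin d → 𝔸ˣ) (A' : Site d → Fin d → 𝔸),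
        (∀ x, u x ∈ unitaryUnits 𝔸) → (∀ x, x ∉ Ω 0 → u x = 1) → mgauge U₀ u W = U' → Restr129 L m (Λs m) U₀ u →
        IsLandau138W L m η (Ω 0) (Λs m) U₀ W → (∀ y τ, IsSelfAdjoint (A' y τ)) →
        (∀ j, j ≤ m → ∀ y τ, SideTouches (Ω j) y τ →
        W y τ = cfgExp η A' y τ ∧ ‖A' y τ‖ ≤ (2 * (L * (5 * (d : ℝ) * L * B₀ * (α₀ + α₁))) + 8 * (8 * B₀' * (5 * (d : ℝ) * L * B₀) * (α₀ + α₁))) * ((L : ℝ) ^ j * η)⁻¹) →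
        (∀ y τ, (∀ j, j ≤ m → ¬ SideTouches (Ω j) y τ) → A' y τ = 0) →
        msup L m η (-(1 : ℝ)) (fun j (b : Site d × Fin d) => SideTouches (Ω j) b.1 b.2) (fun b => A' b.1 b.2)
        ≤ B₀ * (bondNorm L m η (-(3 : ℝ)) Ω (fun x μ => Jcur η U₀ A' μ x)
        + wsup 1 (fun p : {p : ℕ × (Site d × Fin d) // p.1 ≤ m ∧ (p.2 ∈ Λb m p.1 ∨ (p.1 = 0 ∧ CrossB (Ω 0) p.2))} =>
        linCovIter L U₀ (iEta η A') p.1.1 p.1.2.1 p.1.2.2))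
        + Bbd * msup L m η (-(1 : ℝ)) (fun j (b : Site d × Fin d) => j = 0 ∧ SideTouches (Ω 0) b.1 b.2 ∧ ¬ BondTouches (Ω 0) b.1 b.2)
            (fun b => A' b.1 b.2) ∧
        msup L m η (-(2 : ℝ)) (fun j (t : Fin d × Fin d × Site d) => SideTouches (Ω j) t.2.2 t.2.1)
        (fun t => covDerivFwd η U₀ t.1 (fun z => A' z t.2.1) t.2.2)
        ≤ B₀ * (bondNorm L m η (-(3 : ℝ)) Ω (fun x μ => Jcur η U₀ A' μ x)
        + wsup 1 (fun p : {p : ℕ × (Site d × Fin d) // p.1 ≤ m ∧ (p.2 ∈ Λb m p.1 ∨ (p.1 = 0 ∧ CrossB (Ω 0) p.2))} =>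
        linCovIter L U₀ (iEta η A') p.1.1 p.1.2.1 p.1.2.2))
        + Bbd * msup L m η (-(1 : ℝ)) (fun j (b : Site d × Fin d) => j = 0 ∧ SideTouches (Ω 0) b.1 b.2 ∧ ¬ BondTouches (Ω 0) b.1 b.2)
            (fun b => A' b.1 b.2)))
    (SP5u : ∀ α₀ α₁ : ℝ, 0 < α₀ → 0 < α₁ → α₀ + α₁ ≤ cP →
      ∀ U₀ U' : Site d → Fin d → 𝔸ˣ, (∀ x κ, U₀ x κ ∈ unitaryUnits 𝔸) → (∀ x κ, U' x κ ∈ unitaryUnits 𝔸) →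
      InAk L k η α₀ Ω U₀ → InAk L k η α₀ Ω (mulCfg U' U₀) → (∀ m, m ≤ k → InAx L m (Λs m) U₀ (mulCfg U' U₀)) →
      (∀ j, j ≤ k → ∀ (z : Site d) (μ : Fin d), (∀ x, InBox (loK L j z) (bondHiK L j z μ) x → x ∈ Ω j) →
        ‖(avgIter L (mulCfg U' U₀) j z μ : 𝔸) - (avgIter L U₀ j z μ : 𝔸)‖ ≤ α₁) →
      (∀ b ∈ {b : Site d × Fin d | SideTouches (Ω 0) b.1 b.2}, ‖((U' b.1 b.2 : 𝔸ˣ) : 𝔸) - 1‖ ≤ α₁) →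
      ∀ u₁ : Site d → 𝔸ˣ, (∀ x, u₁ x ∈ unitaryUnits 𝔸) → Restr129 L k (Λs k) U₀ u₁ →
      ∀ (v w : Site d → 𝔸ˣ) (lam mu : Site d → 𝔸),
      (∀ j, j ≤ k → ∀ y ∈ Λs k j, ∀ x : Site d, InBox (tlo L y j) (thi L y j) x →
        ((gaugeExp lam x : 𝔸ˣ) : 𝔸) = ((v x : 𝔸ˣ) : 𝔸) ∧ IsSelfAdjoint (lam x) ∧ ‖lam x‖ < cu ∧
          ∀ κ : Fin d, InBox (tlo L y j) (thi L y j) (x + e κ) → ((L : ℝ) ^ j * η) * ‖covDerivFwd η U₀ κ lam x‖ < cu) →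
      (∀ j, j ≤ k → ∀ y ∈ Λs k j, ∀ x : Site d, InBox (tlo L y j) (thi L y j) x →
        ((gaugeExp mu x : 𝔸ˣ) : 𝔸) = ((w x : 𝔸ˣ) : 𝔸) ∧ IsSelfAdjoint (mu x) ∧ ‖mu x‖ < cu ∧
          ∀ κ : Fin d, InBox (tlo L y j) (thi L y j) (x + e κ) → ((L : ℝ) ^ j * η) * ‖covDerivFwd η U₀ κ mu x‖ < cu) →
      IsLandau138W L k η (Ω 0) (Λs k) U₀ (mgauge U₀ v⁻¹ (mgauge U₀ u₁⁻¹ U')) → Restr129 L k (Λs k) U₀ (u₁ * v) →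
      IsLandau138W L k η (Ω 0) (Λs k) U₀ (mgauge U₀ w⁻¹ (mgauge U₀ u₁⁻¹ U')) → Restr129 L k (Λs k) U₀ (u₁ * w) →
      ∀ j, j ≤ k → ∀ y ∈ Λs k j, ∀ x : Site d, InBox (tlo L y j) (thi L y j) x → v x = w x),
      ∀ α₀ α₁ : ℝ, 0 < α₀ → 0 < α₁ → α₀ + α₁ ≤ c₁ →
      ∀ U₀ U' : Site d → Fin d → 𝔸ˣ, (∀ x κ, U₀ x κ ∈ unitaryUnits 𝔸) → (∀ x κ, U' x κ ∈ unitaryUnits 𝔸) →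
      InAk L k η α₀ Ω U₀ → InAk L k η α₀ Ω (mulCfg U' U₀) → (∀ m, m ≤ k → InAx L m (Λs m) U₀ (mulCfg U' U₀)) →
      (∀ j, j ≤ k → ∀ (z : Site d) (μ : Fin d), (∀ x, InBox (loK L j z) (bondHiK L j z μ) x → x ∈ Ω j) →
        ‖(avgIter L (mulCfg U' U₀) j z μ : 𝔸) - (avgIter L U₀ j z μ : 𝔸)‖ ≤ α₁) →
      (∀ b ∈ {b : Site d × Fin d | SideTouches (Ω 0) b.1 b.2}, ‖((U' b.1 b.2 : 𝔸ˣ) : 𝔸) - 1‖ ≤ α₁) →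
      ∃ u : Site d → 𝔸ˣ, (∀ x, u x ∈ unitaryUnits 𝔸) ∧ (∀ x, x ∉ Ω 0 → u x = 1) ∧ Restr129 L k (Λs k) U₀ u ∧
        (1 ≤ k → IsLandau138W L k η (Ω 0) (Λs k) U₀ (mgauge U₀ u⁻¹ U')) ∧
        (∀ j, j ≤ k → ∀ b ∈ {b : Site d × Fin d | SideTouches (Ω j) b.1 b.2},
          mgauge U₀ u⁻¹ U' b.1 b.2 = cfgExp η (logCfg η (mgauge U₀ u⁻¹ U')) b.1 b.2 ∧
            IsSelfAdjoint (logCfg η (mgauge U₀ u⁻¹ U') b.1 b.2) ∧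
            ‖logCfg η (mgauge U₀ u⁻¹ U') b.1 b.2‖ ≤ (5 * (d : ℝ) * L * B₀ * (α₀ + α₁)) * ((L : ℝ) ^ j * η)⁻¹) ∧
        ∀ u' : Site d → 𝔸ˣ, (∀ x, u' x ∈ unitaryUnits 𝔸) → (∀ x, x ∉ Ω 0 → u' x = 1) → Restr129 L k (Λs k) U₀ u' →
          IsLandau138W L k η (Ω 0) (Λs k) U₀ (mgauge U₀ u'⁻¹ U') →
          (∃ A' : Site d → Fin d → 𝔸, ∀ j, j ≤ k → ∀ (x : Site d) (κ : Fin d), SideTouches (Ω j) x κ →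
            mgauge U₀ u'⁻¹ U' x κ = cfgExp η A' x κ ∧ ‖A' x κ‖ ≤ (5 * (d : ℝ) * L * B₀ * (α₀ + α₁)) * ((L : ℝ) ^ j * η)⁻¹) →
          (1 ≤ k) → u' = u := by
  have hL1 : 1 ≤ L := le_trans (by norm_num) hL
  have hd1 : 1 ≤ d := le_trans (by norm_num) hd2
  have hd' : (1 : ℝ) ≤ d := by exact_mod_cast hd1
  have hL' : (1 : ℝ) ≤ L := by exact_mod_cast hL1
  obtain ⟨c₁, hc₁, hw⟩ := thm4_windows hd1 hL1 hB₀ hB₀' hB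
  obtain ⟨c₂, hc₂, hw'⟩ := thm4_windows_extra (d := d) hL1
  -- the threshold for Proposition 5's uniqueness radius: `2000·d·c⋆ ≤ cu`
  obtain ⟨c₃, hc₃def⟩ : ∃ c₃ : ℝ, c₃ = cu / (2000 * d * (5 * d * L * B₀)) := ⟨_, rfl⟩
  have hc₃ : 0 < c₃ := by rw [hc₃def]; positivity
  refine ⟨min (min c₁ c₂) (min cP c₃), lt_min (lt_min hc₁ hc₂) (lt_min hcP hc₃), ?_⟩
  intro η hη k Ω hΩ Λs Λb hbox hclass htower hpart hlay SP5base SP5 SH59Dβ SP5u α₀ α₁ hα₀ hα₁ hS U₀ U' hU₀ hU' h33 h34 hAx h135 h66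
  have hS1 : α₀ + α₁ ≤ c₁ := hS.trans ((min_le_left _ _).trans (min_le_left _ _))
  have hS2 : α₀ + α₁ ≤ c₂ := hS.trans ((min_le_left _ _).trans (min_le_right _ _))
  have hSP : α₀ + α₁ ≤ cP := hS.trans ((min_le_right _ _).trans (min_le_left _ _))
  have hS3 : α₀ + α₁ ≤ c₃ := hS.trans ((min_le_right _ _).trans (min_le_right _ _))
  have hS0 : 0 ≤ α₀ + α₁ := by linarith
  obtain ⟨w1, w2, w3, w4, w5, w6, w7, w8, w9, w10, w11, w12, w13, w14, w15, w16, w17, w18⟩ :=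
    hw α₀ α₁ hα₀ hα₁ hS1 (5 * (d : ℝ) * L * B₀ * (α₀ + α₁)) (8 * B₀' * (5 * (d : ℝ) * L * B₀) * (α₀ + α₁)) rfl rfl
  obtain ⟨w19, w20⟩ := hw' α₀ α₁ hα₀ hα₁ hS2
  have hcs0 : 0 ≤ 5 * (d : ℝ) * L * B₀ * (α₀ + α₁) := by positivity
  have hα₄0 : 0 ≤ 8 * B₀' * (5 * (d : ℝ) * L * B₀) * (α₀ + α₁) := by positivity
  -- EXISTENCE (support form) at the top level `k`
  -- the exterior-collar window at the datum's (1.66)₀ level `a := α₁`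
  have hbdry : 4 * Bbd * α₁ ≤ ((d : ℝ) * L - 1) * B₀ * (α₀ + α₁) := by
    have h1 : 4 * Bbd * α₁ ≤ ((d : ℝ) * L - 1) * B₀ * α₁ := mul_le_mul_of_nonneg_right hBd hα₁.le
    have h2 : 0 ≤ ((d : ℝ) * L - 1) * B₀ := le_trans (by positivity) hBd
    have h3 : ((d : ℝ) * L - 1) * B₀ * α₁ ≤ ((d : ℝ) * L - 1) * B₀ * (α₀ + α₁) :=
      mul_le_mul_of_nonneg_left (le_add_of_nonneg_left hα₀.le) h2
    exact h1.trans h3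
  obtain ⟨u, hu, huS, h129, W, hW, hLan, A, hA⟩ := thm4_exists_all_levels_supp_landau138_bdryβ hd2 hη hL k hU₀ hU' hα₀ hα₁ hα₄0 hB₀.le
    rfl w1 w2 w3 w4 w5 w6 w7 w8 w9 w10 w11 w12 w19 hBbd hα₁.le hbdry w13 w14 Ω hΩ Λs Λb hbox hclass h33 h34 hAx h135 h66 hlay
    (le_mul_of_one_le_left hα₁.le (one_le_mul_of_one_le_of_one_le hd' hL'))
    (SP5base α₀ α₁ hα₀ hα₁ hSP U₀ U' hU₀ hU' h33 h34 hAx h135 h66) (SP5 α₀ α₁ hα₀ hα₁ hSP U₀ U' hU₀ hU' h33 h34 hAx h135 h66)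
    (SH59Dβ α₀ α₁ hα₀ hα₁ hSP U₀ U' hU₀ hU' h33 h34 hAx h135 h66) k le_rfl
  have hWeq : W = mgauge U₀ u⁻¹ U' := eq_mgauge_inv_of_mgauge_eq hW
  have hWu : ∀ x κ, W x κ ∈ unitaryUnits 𝔸 := mem_unitaryUnits_of_mgauge_eq hU₀ hU' hu hW
  -- `c⋆ ≤ 1/16` for the logarithm device
  have hc16 : 5 * (d : ℝ) * L * B₀ * (α₀ + α₁) ≤ 1 / 16 := by
    have h₁ : (1 : ℝ) * (5 * (d : ℝ) * L * B₀ * (α₀ + α₁)) ≤ L * (5 * (d : ℝ) * L * B₀ * (α₀ + α₁)) :=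
      mul_le_mul_of_nonneg_right hL' hcs0
    linarith
  -- the exponent read back as `logCfg`
  have hleaf : ∀ j, j ≤ k → ∀ b ∈ {b : Site d × Fin d | SideTouches (Ω j) b.1 b.2},
      mgauge U₀ u⁻¹ U' b.1 b.2 = cfgExp η (logCfg η (mgauge U₀ u⁻¹ U')) b.1 b.2 ∧
        IsSelfAdjoint (logCfg η (mgauge U₀ u⁻¹ U') b.1 b.2) ∧
        ‖logCfg η (mgauge U₀ u⁻¹ U') b.1 b.2‖ ≤ (5 * (d : ℝ) * L * B₀ * (α₀ + α₁)) * ((L : ℝ) ^ j * η)⁻¹ := by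
    intro j hj b hb
    obtain ⟨hexp, -, hbd⟩ := hA j hj b hb
    have hbd' : ‖A b.1 b.2‖ ≤ (5 * (d : ℝ) * L * B₀ * (α₀ + α₁)) * η⁻¹ := by
      refine hbd.trans ?_
      have hLj : (1 : ℝ) ≤ (L : ℝ) ^ j := one_le_pow₀ hL'
      have : ((L : ℝ) ^ j * η)⁻¹ ≤ η⁻¹ := by
        rw [mul_inv]
        calc ((L : ℝ) ^ j)⁻¹ * η⁻¹ ≤ 1 * η⁻¹ := by gcongr; exact inv_le_one_of_one_le₀ hLj
          _ = η⁻¹ := one_mul _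
      exact mul_le_mul_of_nonneg_left this hcs0
    obtain ⟨hlogA, hsa, hWexp⟩ := logField_spec hη U₀ hWu hexp hbd' hc16
    rw [← hWeq]
    refine ⟨hWexp, ?_, ?_⟩
    · simpa [logCfg] using hsa
    · show ‖logCfg η W b.1 b.2‖ ≤ _
      rw [logCfg, hlogA]
      exact hbd
  refine ⟨u, hu, huS, h129, fun hk => hWeq ▸ hLan hk, hleaf, ?_⟩
  -- UNIQUENESS: any other restricted u′ with (1.38) and the (1.62)-shape equals u
  intro u' hu' hu'S h129' hLan' h162' hk1
  have hk_Lan : IsLandau138W L k η (Ω 0) (Λs k) U₀ (mgauge U₀ u⁻¹ U') := hWeq ▸ hLan hk1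
  have h162 : ∃ A₂ : Site d → Fin d → 𝔸, ∀ j, j ≤ k → ∀ (x : Site d) (κ : Fin d), SideTouches (Ω j) x κ →
      mgauge U₀ u⁻¹ U' x κ = cfgExp η A₂ x κ ∧ ‖A₂ x κ‖ ≤ (5 * (d : ℝ) * L * B₀ * (α₀ + α₁)) * ((L : ℝ) ^ j * η)⁻¹ := by
    refine ⟨A, fun j hj x κ hxκ => ?_⟩
    obtain ⟨hexp, -, hbd⟩ := hA j hj (x, κ) hxκ
    rw [← hWeq]
    exact ⟨hexp, hbd⟩
  -- the windows of the uniqueness clause at `c := c⋆`, `α_P := α₀`, and Prop. 5's radius `cu`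
  obtain ⟨cs, hcsdef⟩ : ∃ cs : ℝ, cs = 5 * (d : ℝ) * L * B₀ * (α₀ + α₁) := ⟨_, rfl⟩
  have hcs0' : 0 ≤ cs := by rw [hcsdef]; positivity
  have h2000 : 2000 * (d : ℝ) * cs ≤ cu := by
    have hden : 0 < 2000 * (d : ℝ) * (5 * d * L * B₀) := by positivity
    have h := (le_div_iff₀ hden).1 (hS3.trans (le_of_eq hc₃def))
    have e : 2000 * (d : ℝ) * cs = (α₀ + α₁) * (2000 * d * (5 * d * L * B₀)) := by rw [hcsdef]; ring
    linarith
  have hcu₂ : 5 * cs < cu := by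
    have h₁ : (1 : ℝ) * cs ≤ d * cs := mul_le_mul_of_nonneg_right hd' hcs0'
    have hdcs : 0 ≤ (d : ℝ) * cs := by positivity
    linarith
  have hcu₁ : 2 * (2 * (40 * d * cs) + 2 * 1116 * (40 * d * cs) ^ 2) < cu := by
    have hx0 : 0 ≤ 40 * d * cs := by positivity
    have hx1 : 40 * d * cs ≤ 1 / 5000 := by rw [hcsdef]; exact w16
    have hsq : (40 * d * cs) ^ 2 ≤ 40 * d * cs * (1 / 5000) := by rw [sq]; exact mul_le_mul_of_nonneg_left hx1 hx0
    have hdcs : 0 ≤ (d : ℝ) * cs := by positivity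
    linarith
  rw [hcsdef] at hcu₁ hcu₂
  exact thm4_unique_eq_landau138 hd2 hL hη hU₀ hU' hu' hu hα₀ w5 w6 hcs0 w18 w17 w15 w16 hα₀ w5 w20 hcu₁ hcu₂ h33
    (by rw [← mulCfg_eq_mul]; exact h34) (by rw [← mulCfg_eq_mul]; exact hAx k le_rfl) htower h129' h129 hLan' hk_Lan h162' h162
    (SP5u α₀ α₁ hα₀ hα₁ hSP U₀ U' hU₀ hU' h33 h34 hAx h135 h66 u' hu' h129') hpart hu'S huS

end Main

#print axioms thm4Body_concrete_uniform_bdryβ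

/-! ## §2 The member sentence and the printed sentence on index-mapped sub-families -/

section Member

variable {𝔸 : Type} [CStarAlgebra 𝔸] [Nontrivial 𝔸]

/-- ★ **`B8.Thm4Body (5dLB₀)` AT ONE MEMBER of `zdGF3`, SOCKETS INSIDE, THE (1.59) SOCKET IN EDITION β** (Theorem 4, p. 88): g6's
`B8LeafModelZd3Bdry.thm4Body_member_zd3_bdry` run on `thm4Body_concrete_uniform_bdryβ` — ONE threshold `c₁(d, L, B₀, B₀′, cu, cP)` before the member; the
member's boundary-layer law; sockets `SockP5base` ∕ `SockP5` ∕ the β (1.59) socket (INLINE: support clause «`u = 1` off `Ω₀`», `|B₁|β`, collar term `+ B_∂·Φ₀(A′)`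
= the body of `SockB9P3D4β` at the induction datum) ∕ `SockP5u` AT THAT MEMBER; side condition `0 ≤ B_∂`, `4B_∂ ≤ (dL − 1)B₀`.  Proof verbatim.
[cite: Balaban1985RegularSpaces, Thm 4 p.88, (1.29) p.81, (1.31) p.82, (1.37)–(1.38) p.82, (1.58)–(1.62) pp.86–87, Prop. 5 (1.107)–(1.109) p.94, pp.94–95] -/
theorem thm4Body_member_zd3_bdryβ (hd2 : 2 ≤ d) {L : ℕ} (hL : 2 ≤ L) (β : ℝ) (len : Site d → ℝ) {B₀ B₀' cu cP Bbd : ℝ} (hB₀ : 0 < B₀)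
    (hB₀' : 0 < B₀') (hB : 2 ≤ 5 * (d : ℝ) * L * B₀) (hcu : 0 < cu) (hcP : 0 < cP) (hBbd : 0 ≤ Bbd) (hBd : 4 * Bbd ≤ ((d : ℝ) * L - 1) * B₀) :
    ∃ c₁ : ℝ, 0 < c₁ ∧ ∀ i : ZdIdx d L,
      -- the boundary-layer law of the member: a site of `Ω₀` with a sup-distance-1 neighbour outside `Ω₀` lies in `Λs m 0`, `1 ≤ m ≤ k`
      (∀ m, 1 ≤ m → m ≤ i.k → ∀ y z : Site d, y ∈ i.Ω 0 → z ∉ i.Ω 0 → (∀ l, y l - 1 ≤ z l ∧ z l ≤ y l + 1) → y ∈ i.Λs m 0) →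
      SockP5base (𝔸 := 𝔸) L B₀ B₀' cP i.η i.k i.Ω i.Λs → SockP5 (𝔸 := 𝔸) L B₀ B₀' cP i.η i.k i.Ω i.Λs →
      -- the (1.59) socket IN THE REPAIRED CURRENCY at this member (support clause; exterior-collar term with constant `Bbd`)
      (∀ α₀ α₁ : ℝ, 0 < α₀ → 0 < α₁ → α₀ + α₁ ≤ cP →
        ∀ U₀ U' : Site d → Fin d → 𝔸ˣ, (∀ x κ, U₀ x κ ∈ unitaryUnits 𝔸) → (∀ x κ, U' x κ ∈ unitaryUnits 𝔸) →
        InAk L i.k i.η α₀ i.Ω U₀ → InAk L i.k i.η α₀ i.Ω (mulCfg U' U₀) → (∀ m, m ≤ i.k → InAx L m (i.Λs m) U₀ (mulCfg U' U₀)) →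
        (∀ j, j ≤ i.k → ∀ (z : Site d) (μ : Fin d), (∀ x, InBox (loK L j z) (bondHiK L j z μ) x → x ∈ i.Ω j) →
          ‖(avgIter L (mulCfg U' U₀) j z μ : 𝔸) - (avgIter L U₀ j z μ : 𝔸)‖ ≤ α₁) →
        (∀ b ∈ {b : Site d × Fin d | SideTouches (i.Ω 0) b.1 b.2}, ‖((U' b.1 b.2 : 𝔸ˣ) : 𝔸) - 1‖ ≤ α₁) →
        (∀ m, 1 ≤ m → m ≤ i.k → ∀ (u : Site d → 𝔸ˣ) (W : Site d → Fin d → 𝔸ˣ) (A' : Site d → Fin d → 𝔸),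
          (∀ x, u x ∈ unitaryUnits 𝔸) → (∀ x, x ∉ i.Ω 0 → u x = 1) → mgauge U₀ u W = U' → Restr129 L m (i.Λs m) U₀ u →
          IsLandau138W L m i.η (i.Ω 0) (i.Λs m) U₀ W → (∀ y τ, IsSelfAdjoint (A' y τ)) →
          (∀ j, j ≤ m → ∀ y τ, SideTouches (i.Ω j) y τ →
          W y τ = cfgExp i.η A' y τ ∧ ‖A' y τ‖ ≤ (2 * (L * (5 * (d : ℝ) * L * B₀ * (α₀ + α₁))) + 8 * (8 * B₀' * (5 * (d : ℝ) * L * B₀) * (α₀ + α₁))) * ((L : ℝ) ^ j * i.η)⁻¹) →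
          (∀ y τ, (∀ j, j ≤ m → ¬ SideTouches (i.Ω j) y τ) → A' y τ = 0) →
          msup L m i.η (-(1 : ℝ)) (fun j (b : Site d × Fin d) => SideTouches (i.Ω j) b.1 b.2) (fun b => A' b.1 b.2)
          ≤ B₀ * (bondNorm L m i.η (-(3 : ℝ)) i.Ω (fun x μ => Jcur i.η U₀ A' μ x)
          + wsup 1 (fun p : {p : ℕ × (Site d × Fin d) // p.1 ≤ m ∧ (p.2 ∈ i.Λb m p.1 ∨ (p.1 = 0 ∧ CrossB (i.Ω 0) p.2))} =>
          linCovIter L U₀ (iEta i.η A') p.1.1 p.1.2.1 p.1.2.2))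
          + Bbd * msup L m i.η (-(1 : ℝ)) (fun j (b : Site d × Fin d) => j = 0 ∧ SideTouches (i.Ω 0) b.1 b.2 ∧ ¬ BondTouches (i.Ω 0) b.1 b.2)
              (fun b => A' b.1 b.2) ∧
          msup L m i.η (-(2 : ℝ)) (fun j (t : Fin d × Fin d × Site d) => SideTouches (i.Ω j) t.2.2 t.2.1)
          (fun t => covDerivFwd i.η U₀ t.1 (fun z => A' z t.2.1) t.2.2)
          ≤ B₀ * (bondNorm L m i.η (-(3 : ℝ)) i.Ω (fun x μ => Jcur i.η U₀ A' μ x)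
          + wsup 1 (fun p : {p : ℕ × (Site d × Fin d) // p.1 ≤ m ∧ (p.2 ∈ i.Λb m p.1 ∨ (p.1 = 0 ∧ CrossB (i.Ω 0) p.2))} =>
          linCovIter L U₀ (iEta i.η A') p.1.1 p.1.2.1 p.1.2.2))
          + Bbd * msup L m i.η (-(1 : ℝ)) (fun j (b : Site d × Fin d) => j = 0 ∧ SideTouches (i.Ω 0) b.1 b.2 ∧ ¬ BondTouches (i.Ω 0) b.1 b.2)
              (fun b => A' b.1 b.2))) →
      SockP5u (𝔸 := 𝔸) L cP cu i.η i.k i.Ω i.Λs →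
      B8.Thm4Body c₁ (5 * (d : ℝ) * L * B₀) (fun _ : Unit => (zdGF3 𝔸 L β len i).toGFData) := by
  have hL1 : 1 ≤ L := le_trans (by norm_num) hL
  have hd1 : 1 ≤ d := le_trans (by norm_num) hd2
  have hL' : (1 : ℝ) ≤ L := by exact_mod_cast hL1
  obtain ⟨c₁, hc₁, H⟩ := thm4Body_concrete_uniform_bdryβ (𝔸 := 𝔸) hd2 hL hB₀ hB₀' hB hcu hcP hBbd hBd
  obtain ⟨cw, hcw, hw⟩ := thm4_windows hd1 hL1 hB₀ hB₀' hB
  obtain ⟨cw', hcw', hw'⟩ := thm4_windows_extra (d := d) hL1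
  refine ⟨min c₁ (min cw cw'), lt_min hc₁ (lt_min hcw hcw'), ?_⟩
  intro i hlay SP5base SP5 SH59Dβ SP5u _ α₀ α₁ hα₀ hα₁ hs U₀ P hInA _ hInAAx h166
  have hs₁ : α₀ + α₁ ≤ c₁ := hs.trans (min_le_left _ _)
  have hsw : α₀ + α₁ ≤ cw := hs.trans ((min_le_right _ _).trans (min_le_left _ _))
  have hsw' : α₀ + α₁ ≤ cw' := hs.trans ((min_le_right _ _).trans (min_le_right _ _))
  obtain ⟨hP1, h34, hAx⟩ := hInAAx
  obtain ⟨h135, h66⟩ := h166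
  subst hP1
  obtain ⟨u, hu, huS, h129, hLan, hleaf, huniq⟩ := H i.η i.hη i.k i.Ω i.hΩ i.Λs i.Λb i.hbox i.hclass i.htower i.hpart hlay
    SP5base SP5 SH59Dβ SP5u α₀ α₁ hα₀ hα₁ hs₁ P.1.1 P.2.1 P.1.2 P.2.2 hInA h34 hAx h135 h66
  -- windows for the (1.42) lemma
  obtain ⟨-, -, -, -, w5, w6, w7, -, w9, w10, -, -, -, -, -, -, -, -⟩ :=
    hw α₀ α₁ hα₀ hα₁ hsw (5 * (d : ℝ) * L * B₀ * (α₀ + α₁)) (8 * B₀' * (5 * (d : ℝ) * L * B₀) * (α₀ + α₁)) rfl rfl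
  obtain ⟨w19, -⟩ := hw' α₀ α₁ hα₀ hα₁ hsw'
  have hcs0 : 0 ≤ 5 * (d : ℝ) * L * B₀ * (α₀ + α₁) := by positivity
  have hKS0 : 0 ≤ 2 * (L * (5 * (d : ℝ) * L * B₀ * (α₀ + α₁))) + 8 * (8 * B₀' * (5 * (d : ℝ) * L * B₀) * (α₀ + α₁)) := by
    positivity
  have hcK : 5 * (d : ℝ) * L * B₀ * (α₀ + α₁) ≤
      2 * (L * (5 * (d : ℝ) * L * B₀ * (α₀ + α₁))) + 8 * (8 * B₀' * (5 * (d : ℝ) * L * B₀) * (α₀ + α₁)) := by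
    have h₁ : (1 : ℝ) * (5 * (d : ℝ) * L * B₀ * (α₀ + α₁)) ≤ L * (5 * (d : ℝ) * L * B₀ * (α₀ + α₁)) :=
      mul_le_mul_of_nonneg_right hL' hcs0
    have h₂ : 0 ≤ 8 * (8 * B₀' * (5 * (d : ℝ) * L * B₀) * (α₀ + α₁)) := by positivity
    linarith
  have hc16 : 16 * (5 * (d : ℝ) * L * B₀ * (α₀ + α₁)) ≤ 1 := by linarith
  -- the gauge-fixed field and its CANONICAL masked exponent
  have hW : mgauge P.1.1 u (mgauge P.1.1 u⁻¹ P.2.1) = P.2.1 := mgauge_mgauge_inv P.1.1 P.2.1 u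
  have hWu : ∀ x κ, mgauge P.1.1 u⁻¹ P.2.1 x κ ∈ unitaryUnits 𝔸 := mem_unitaryUnits_of_mgauge_eq P.1.2 P.2.2 hu hW
  have hWA : ∀ j, j ≤ i.k → ∀ y τ, SideTouches (i.Ω j) y τ →
      mgauge P.1.1 u⁻¹ P.2.1 y τ = cfgExp i.η (logCfg i.η (mgauge P.1.1 u⁻¹ P.2.1)) y τ ∧
        ‖logCfg i.η (mgauge P.1.1 u⁻¹ P.2.1) y τ‖ ≤ (5 * (d : ℝ) * L * B₀ * (α₀ + α₁)) * ((L : ℝ) ^ j * i.η)⁻¹ :=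
    fun j hj y τ h => ⟨(hleaf j hj (y, τ) h).1, (hleaf j hj (y, τ) h).2.2⟩
  obtain ⟨hA'sa, hA'eq, hA'zero⟩ := mlogCfg_spec i.hη hL1 i.k P.1.1 hWu hcs0 hc16 i.Ω hWA
  set A' := mlogCfg i.k i.η i.Ω (mgauge P.1.1 u⁻¹ P.2.1) with hA'_def
  have hA'bd : ∀ j, j ≤ i.k → ∀ y τ, SideTouches (i.Ω j) y τ →
      mgauge P.1.1 u⁻¹ P.2.1 y τ = cfgExp i.η A' y τ ∧
        ‖A' y τ‖ ≤ (2 * (L * (5 * (d : ℝ) * L * B₀ * (α₀ + α₁))) + 8 * (8 * B₀' * (5 * (d : ℝ) * L * B₀) * (α₀ + α₁))) *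
          ((L : ℝ) ^ j * i.η)⁻¹ := by
    intro j hj y τ h
    obtain ⟨hAA, hWexp⟩ := hA'eq j hj y τ h
    refine ⟨hWexp, ?_⟩
    rw [hAA]
    have hη0 : 0 ≤ i.η := i.hη.le
    exact ((hWA j hj y τ h).2).trans (mul_le_mul_of_nonneg_right hcK (by positivity))
  have h137 := B8Eq142KLevelLocal.H42_of_inAx hd2 i.hη hL i.k P.1.2 hα₀ hα₁ hKS0 w5 w6 w7 w9 w10 w19 i.Ω i.hΩ i.Λs i.Λb i.hbox
    i.hclass hInA h34 hAx h135 (fun m W => IsLandau138W L m i.η (i.Ω 0) (i.Λs m) P.1.1 W) i.k i.hk le_rfl u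
    (mgauge P.1.1 u⁻¹ P.2.1) A' hu hW h129 (hLan i.hk) hA'sa hA'bd hA'zero
  refine ⟨⟨u, hu, huS⟩, h129, ⟨h137, hLan i.hk, ?_⟩, ?_⟩
  · intro j hj b hb
    exact hleaf j hj b hb
  · intro u' hR' _ hLan' h162'
    apply Subtype.ext
    refine huniq u'.1 u'.2.1 u'.2.2 hR' hLan' ⟨logCfg i.η (mgauge P.1.1 u'.1⁻¹ P.2.1), fun j hj x κ h => ?_⟩ i.hk
    exact ⟨(h162' j hj (x, κ) h).1, (h162' j hj (x, κ) h).2.2⟩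

/-- ★ **`B8.Thm4Printed (5dLB₀)` ON AN INDEX-MAPPED SUB-FAMILY `fam₃ ∘ ι`** of `zdGF3` (`ι : J → ZdIdx d L`) whose members obey the boundary-layer
law, from the four sockets on the image of `ι` only, the (1.59) socket in edition β (INLINE, per member: the body of `SockB9P3D4β` at the induction datum).
At `J :=` the cube sub-family of (1.131) (law `hlay` discharged there) this is the PROVIDER of the `H4` of `B8Prop6CubeMemberGaugedBdryBeta`.
[cite: Balaban1985RegularSpaces, Thm 4 p.88, Prop. 5 p.94, (1.59) p.86, (1.31) p.82] -/
theorem thm4Printed_zd3_map_bdryβ (hd2 : 2 ≤ d) {L : ℕ} (hL : 2 ≤ L) {β : ℝ} {len : Site d → ℝ} {B₀ B₀' cu cP Bbd : ℝ} (hB₀ : 0 < B₀)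
    (hB₀' : 0 < B₀') (hB : 2 ≤ 5 * (d : ℝ) * L * B₀) (hcu : 0 < cu) (hcP : 0 < cP) (hBbd : 0 ≤ Bbd) (hBd : 4 * Bbd ≤ ((d : ℝ) * L - 1) * B₀)
    {J : Type} (ι : J → ZdIdx d L)
    (hlay : ∀ j : J, ∀ m, 1 ≤ m → m ≤ (ι j).k → ∀ y z : Site d, y ∈ (ι j).Ω 0 → z ∉ (ι j).Ω 0 →
      (∀ l, y l - 1 ≤ z l ∧ z l ≤ y l + 1) → y ∈ (ι j).Λs m 0)
    (SP5base : ∀ j : J, SockP5base (𝔸 := 𝔸) L B₀ B₀' cP (ι j).η (ι j).k (ι j).Ω (ι j).Λs)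
    (SP5 : ∀ j : J, SockP5 (𝔸 := 𝔸) L B₀ B₀' cP (ι j).η (ι j).k (ι j).Ω (ι j).Λs)
    (SH59Dβ : ∀ j : J, ∀ α₀ α₁ : ℝ, 0 < α₀ → 0 < α₁ → α₀ + α₁ ≤ cP →
        ∀ U₀ U' : Site d → Fin d → 𝔸ˣ, (∀ x κ, U₀ x κ ∈ unitaryUnits 𝔸) → (∀ x κ, U' x κ ∈ unitaryUnits 𝔸) →
        InAk L (ι j).k (ι j).η α₀ (ι j).Ω U₀ → InAk L (ι j).k (ι j).η α₀ (ι j).Ω (mulCfg U' U₀) →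
        (∀ m, m ≤ (ι j).k → InAx L m ((ι j).Λs m) U₀ (mulCfg U' U₀)) →
        (∀ j', j' ≤ (ι j).k → ∀ (z : Site d) (μ : Fin d), (∀ x, InBox (loK L j' z) (bondHiK L j' z μ) x → x ∈ (ι j).Ω j') →
          ‖(avgIter L (mulCfg U' U₀) j' z μ : 𝔸) - (avgIter L U₀ j' z μ : 𝔸)‖ ≤ α₁) →
        (∀ b ∈ {b : Site d × Fin d | SideTouches ((ι j).Ω 0) b.1 b.2}, ‖((U' b.1 b.2 : 𝔸ˣ) : 𝔸) - 1‖ ≤ α₁) →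
        (∀ m, 1 ≤ m → m ≤ (ι j).k → ∀ (u : Site d → 𝔸ˣ) (W : Site d → Fin d → 𝔸ˣ) (A' : Site d → Fin d → 𝔸),
          (∀ x, u x ∈ unitaryUnits 𝔸) → (∀ x, x ∉ (ι j).Ω 0 → u x = 1) → mgauge U₀ u W = U' → Restr129 L m ((ι j).Λs m) U₀ u →
          IsLandau138W L m (ι j).η ((ι j).Ω 0) ((ι j).Λs m) U₀ W → (∀ y τ, IsSelfAdjoint (A' y τ)) →
          (∀ j', j' ≤ m → ∀ y τ, SideTouches ((ι j).Ω j') y τ →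
          W y τ = cfgExp (ι j).η A' y τ ∧ ‖A' y τ‖ ≤ (2 * (L * (5 * (d : ℝ) * L * B₀ * (α₀ + α₁))) + 8 * (8 * B₀' * (5 * (d : ℝ) * L * B₀) * (α₀ + α₁))) * ((L : ℝ) ^ j' * (ι j).η)⁻¹) →
          (∀ y τ, (∀ j', j' ≤ m → ¬ SideTouches ((ι j).Ω j') y τ) → A' y τ = 0) →
          msup L m (ι j).η (-(1 : ℝ)) (fun j' (b : Site d × Fin d) => SideTouches ((ι j).Ω j') b.1 b.2) (fun b => A' b.1 b.2)
          ≤ B₀ * (bondNorm L m (ι j).η (-(3 : ℝ)) (ι j).Ω (fun x μ => Jcur (ι j).η U₀ A' μ x)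
          + wsup 1 (fun p : {p : ℕ × (Site d × Fin d) // p.1 ≤ m ∧ (p.2 ∈ (ι j).Λb m p.1 ∨ (p.1 = 0 ∧ CrossB ((ι j).Ω 0) p.2))} =>
          linCovIter L U₀ (iEta (ι j).η A') p.1.1 p.1.2.1 p.1.2.2))
          + Bbd * msup L m (ι j).η (-(1 : ℝ)) (fun j' (b : Site d × Fin d) => j' = 0 ∧ SideTouches ((ι j).Ω 0) b.1 b.2 ∧ ¬ BondTouches ((ι j).Ω 0) b.1 b.2)
              (fun b => A' b.1 b.2) ∧
          msup L m (ι j).η (-(2 : ℝ)) (fun j' (t : Fin d × Fin d × Site d) => SideTouches ((ι j).Ω j') t.2.2 t.2.1)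
          (fun t => covDerivFwd (ι j).η U₀ t.1 (fun z => A' z t.2.1) t.2.2)
          ≤ B₀ * (bondNorm L m (ι j).η (-(3 : ℝ)) (ι j).Ω (fun x μ => Jcur (ι j).η U₀ A' μ x)
          + wsup 1 (fun p : {p : ℕ × (Site d × Fin d) // p.1 ≤ m ∧ (p.2 ∈ (ι j).Λb m p.1 ∨ (p.1 = 0 ∧ CrossB ((ι j).Ω 0) p.2))} =>
          linCovIter L U₀ (iEta (ι j).η A') p.1.1 p.1.2.1 p.1.2.2))
          + Bbd * msup L m (ι j).η (-(1 : ℝ)) (fun j' (b : Site d × Fin d) => j' = 0 ∧ SideTouches ((ι j).Ω 0) b.1 b.2 ∧ ¬ BondTouches ((ι j).Ω 0) b.1 b.2)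
              (fun b => A' b.1 b.2)))
    (SP5u : ∀ j : J, SockP5u (𝔸 := 𝔸) L cP cu (ι j).η (ι j).k (ι j).Ω (ι j).Λs) :
    B8.Thm4Printed (5 * (d : ℝ) * L * B₀) (fun j : J => (zdGF3 𝔸 L β len (ι j)).toGFData) := by
  obtain ⟨c₁, hc₁, H⟩ := thm4Body_member_zd3_bdryβ (𝔸 := 𝔸) hd2 hL β len hB₀ hB₀' hB hcu hcP hBbd hBd
  exact ⟨c₁, hc₁, fun j => H (ι j) (hlay j) (SP5base j) (SP5 j) (SH59Dβ j) (SP5u j) ()⟩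


end Member

#print axioms thm4Body_member_zd3_bdryβ
#print axioms thm4Printed_zd3_map_bdryβ

end Literature.MathematicalPhysics.QuantumFieldTheory.Balaban1983to89.B8Thm4ConcreteBdryBeta

end

/-! ## HONEST SCOPE — VACUOUS AT NESTED MEMBERS AS TYPED (2026-08-27, seat `pub-ymgap-dag-n05-e` g9; director-ym LINE №196, dag-lead DEDUP-349∕350)

This file is MEMBER-GENERIC: its theorems take a (1.59)-type clause or socket in EDITION β (SCALAR SC2-shape, or the 𝔸-valued `SockB9P3D4β` ∕ `H59Dβ` ∕
four-line bodies) over a datum class `Λb` obeying the law «fine box ⊂ Ω_j» (`hbox`, `ZdIdx.hbox`, `cubeLamB` condition 1).  At every NESTED member with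
genuine shells — in particular every cube member of (1.131) with `k ≥ 1` — that law EMPTIES print's crossing bonds of (1.31) at levels `j ≥ 1` and the interior
SHELL GAUGE MODES `∂(𝟙λ)` defeat the clause for ALL constants: there the hypothesis is UNINHABITED and the theorems are VACUOUS AS TYPED — KERNEL CERTIFICATE
dag-n05-c `B8Ineq159FlatShellModeVacuity` (p572834; ref-E g12 READ-11 A6-FINAL) and `…ShellModeVacuityUniv` (p576185, the lawful `Ω₀ = ℤᵈ` towered member).
No claim is made here about tower-free members.  The theorems stay TRUE and PASS-AS-DECLARED.  Nothing of [Balaban1985RegularSpaces] is refuted: print's class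
([B6] (2.3)) contains the crossing bonds and kills the modes (dag-n05-c `B8Ineq159FlatShellModeCrossingDatum`).  SUPERSEDED BY EDITION γ: class dag-n05-c
`cubeLamBP`, socket dag-n06-b `B9SupplySockB9P3ZdGamma`, driver this seat's `B8Eq142KLevelLocalGamma` ∕ `B8Thm4KLevelGamma` (law «box ⊂ Ω_{j−1}»); this file is
kept as history and for its class-independent mechanics, re-run by token swap in γ.  Count-neutral; N05 NOT discharged; nothing continuum ∕ ℝ⁴ ∕ OS ∕
mass-gap ∕ Clay. -/
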